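import Summits.QuantumFields.GaugeBoot.TiltedBoxSiteRP
import Summits.QuantumFields.GaugeBoot.CubicTorusRP
import HarnessLib

/-!
# Site-hyperplane reflection positivity at EVERY real coupling
# (gauge-boot, L3 structural supplement: the sign condition of the site family is idle)

HONEST FRAMING (cell `pub-gaugeboot`, page 1 of every file): the venture produces certified bounds
on lattice expectations at stated coupling, gauge group, dimension and torus size; NOT a mass gap,
NOT a continuum limit, NOT a string tension; NOT Yang–Mills-summit-bearing (barriers
`FixedCouplingUltralocality`, `PerturbativeInvisibility`). This module bounds no expectation.

The lane's mechanism theorem for the reflection THROUGH lattice sites,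
`IsSiteFrame.integral_conj_mul_nonneg` (`TiltedSiteRPPositivity.lean`), and all its instances
(`tiltedBox_siteRP`, `cubicTorus_siteRP`, `cubicTorus_siteRP_negReflect`, `cubicTorus_siteRP_suN`, …)
carry the hypothesis `0 ≤ β`. That hypothesis is IDLE: a site reflection cuts no plaquette
(`∑_p Re tr ρ(U_p) = A(U) + A(ΘU) + M(U)`, `IsSiteFrame.weight_mul_eq`), so the Boltzmann weight
times `conj F(ΘU) F(U)` is `g(U) · conj g(ΘU)` with `g = F · e^{β(A + M/2)}` for EVERY real `β`, and
the tree's core lemma with a shared block (`LatticeRP.integral_splice_mul_conj_comp_of_shared_nonneg`)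
only needs `g` bounded — in the original proof `0 ≤ β` entered solely through the crude bound
`‖g‖ ≤ |C| e^{β · 2N · #plaquettes}` (`norm_gObs_le`), which holds with `|β|` in place of `β`
(`norm_gObs_le_abs` below). This is Fröhlich–Israel–Lieb–Simon 1978 Thm. 2.1 as printed (reflection
in a lattice plane through sites: no condition on the couplings), and it is how the tree's Wave 0
theorem `wilsonExpectation_siteReflectionPositive` (axis `0` of the even torus) is already stated:
"ANY real `β` … no sign condition on `β` is needed because every plaquette lies in one closed half".

Contents (all for every real `β`):

* `IsSiteFrame.norm_gObs_le_abs`, `integral_exp_sum_mul_nonneg_anyBeta`,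
  `integral_boltzmann_mul_nonneg_anyBeta`, **`integral_conj_mul_nonneg_anyBeta`**
  (`0 ≤ ∫ conj F(ΘU) F(U) dμ_β` on any finite periodic lattice with a site frame, compact second
  countable `G`, continuous `ρ`, `β ∈ ℝ`, `F` bounded measurable of the closed half `{0 ≤ h ≤ P}`),
  `sum_mul_conj_integral_nonneg_anyBeta` (PSD site RP blocks);
* the tilted box along `k ∉ {i, j}`: `tiltedBox_siteRP_anyBeta`, `tiltedBox_rSiteBlock_nonneg_anyBeta`;
* the cubic torus `(ℤ/2Q)^d` of record, every axis: `cubicTorus_siteRP_anyBeta`,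
  `cubicTorus_siteRP_blocks_nonneg_anyBeta`, `cubicTorus_siteRP_negReflect_anyBeta` (Wave 0's `Θ'`),
  `cubicTorus_siteRP_suN_anyBeta`, `cubicTorus_siteRP_uN_anyBeta`.

What is NOT claimed: the link (mid-plane) family `IsSiteFrame.linkRP_integral_conj_mul_nonneg` and
the diagonal family `IsTiltedFrame.integral_conj_mul_nonneg` DO cut plaquettes and use `0 ≤ β`
through the positive type of the crossing kernel `exp(β Re tr ρ(g h⁻¹))`; nothing is said here about
them at `β < 0`. No certificate of the cell sits at `β < 0`; the point of this module is that the
site RP blocks of a torus bootstrap are sign-free constraints, and that the lane's site family and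
Wave 0's axis-`0` theorem now have literally the same hypotheses (see `CubicTorusWave0Classes.lean`).

References: J. Fröhlich, R. Israel, E. H. Lieb, B. Simon, Comm. Math. Phys. 62 (1978) 1, Thm. 2.1;
K. Osterwalder, E. Seiler, Ann. Phys. 110 (1978) 440, §2; E. Seiler, LNP 159 (1982) Ch. 2;
I. Montvay, G. Münster, Quantum Fields on a Lattice (1994) pp. 180–185.
-/

noncomputable section

open MeasureTheory Complex
open scoped ComplexOrder ComplexConjugate
open Literature.MathematicalPhysics.QuantumFieldTheory (haarProbability LatticeRP.splice
  LatticeRP.splice_eq_piecewise LatticeRP.integral_splice_mul_conj_comp_of_shared_nonneg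
  Site GaugeConfig wilsonMeasure)
open Literature.MathematicalPhysics.QuantumLattice (fundamentalRep unitaryFundamentalRep
  continuous_fundamentalRep continuous_unitaryFundamentalRep)
open Literature.RepresentationTheory.CompactGroups

namespace Summit.QuantumFields.GaugeBoot

namespace TiltedRP

/-! ## The mechanism at every real coupling -/

namespace IsSiteFrame

variable {A : Type*} [AddCommGroup A] [Fintype A] {d : ℕ}
variable {e : Fin d → A} {k : Fin d} {θ : A →+ A} {P : ℕ} {h : A →+ ZMod (2 * P)}
variable (hF : IsSiteFrame e k θ P h)
variable {N : ℕ} {G : Type*} [Group G] [TopologicalSpace G] [IsTopologicalGroup G] [CompactSpace G]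
  [MeasurableSpace G] [BorelSpace G] [SecondCountableTopology G]
variable (ρ : G →* Matrix (Fin N) (Fin N) ℂ)
include hF

open scoped Classical in
omit [MeasurableSpace G] [BorelSpace G] [SecondCountableTopology G] hF in
/-- The observable `g = F · e^{β(A + M/2)}` is bounded for EVERY real `β`:
`‖g(U)‖ ≤ |C| · e^{|β| · 2N · #plaquettes}`. -/
theorem norm_gObs_le_abs (hρ : Continuous ρ) (β : ℝ) {F : Config A d G → ℂ} {CF : ℝ}
    (hFb : ∀ U, ‖F U‖ ≤ CF) (U : Config A d G) :
    ‖gObs ρ e k h β F U‖ ≤ |CF| * Real.exp (|β| * (2 * (N * Fintype.card (Plaq A d)))) := by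
  rw [gObs, norm_mul, Complex.norm_real, Real.norm_eq_abs, abs_of_pos (Real.exp_pos _)]
  refine mul_le_mul ((hFb _).trans (le_abs_self _)) ?_ (Real.exp_pos _).le (abs_nonneg _)
  refine Real.exp_le_exp.2 ?_
  have h1 := abs_sum_plaqObs_le ρ hρ e (Finset.univ.filter (IsSitePosPlaq k P h)) U
  have h2 := abs_sum_plaqObs_le ρ hρ e (Finset.univ.filter (IsSiteMirrorPlaq k P h)) U
  have c1 : ((Finset.univ.filter (IsSitePosPlaq k P h)).card : ℝ) ≤ Fintype.card (Plaq A d) := by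
    exact_mod_cast Finset.card_filter_le _ _
  have c2 : ((Finset.univ.filter (IsSiteMirrorPlaq k P h)).card : ℝ) ≤ Fintype.card (Plaq A d) := by
    exact_mod_cast Finset.card_filter_le _ _
  have hN : (0 : ℝ) ≤ N := Nat.cast_nonneg _
  set A1 := ∑ p ∈ Finset.univ.filter (IsSitePosPlaq k P h), plaqObs ρ e p U
  set M1 := ∑ p ∈ Finset.univ.filter (IsSiteMirrorPlaq k P h), plaqObs ρ e p U
  have hA1 : |A1| ≤ N * Fintype.card (Plaq A d) := h1.trans (by nlinarith)
  have hM1 : |M1| ≤ N * Fintype.card (Plaq A d) := h2.trans (by nlinarith)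
  have hsum : |A1 + M1 / 2| ≤ 2 * (N * Fintype.card (Plaq A d)) := by
    rw [abs_le] at hA1 hM1 ⊢
    constructor <;> linarith [hA1.1, hA1.2, hM1.1, hM1.2]
  calc β * (A1 + M1 / 2) ≤ |β * (A1 + M1 / 2)| := le_abs_self _
    _ = |β| * |A1 + M1 / 2| := abs_mul _ _
    _ ≤ |β| * (2 * (N * Fintype.card (Plaq A d))) :=
        mul_le_mul_of_nonneg_left hsum (abs_nonneg β)

open scoped Classical in
/-- **Reflection positivity of the plaquette weight at every real `β`** (`F` bounded measurable on
the closed half): `0 ≤ ∫ e^{β ∑_p Re tr ρ(U_p)} conj F(ΘU) F(U) ∏ dU`. The proof of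
`integral_exp_sum_mul_nonneg` verbatim, with `norm_gObs_le_abs` for `norm_gObs_le`. -/
theorem integral_exp_sum_mul_nonneg_anyBeta (hρ : Continuous ρ) (β : ℝ)
    {F : Config A d G → ℂ} (hFm : Measurable F) {CF : ℝ} (hFb : ∀ U, ‖F U‖ ≤ CF)
    (hFo : IsHalfObservable e P h F) :
    0 ≤ ∫ U, (Real.exp (β * ∑ p, plaqObs ρ e p U) : ℂ) * (conj (F (configReflect e k θ U)) * F U)
      ∂(productHaar A d G) := by
  classical
  haveI : IsProbabilityMeasure (haarProbability G) :=
    CompactGroup.isProbabilityMeasure_haarMeasure_top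
  simp_rw [hF.weight_mul_eq ρ hρ β F]
  have key := LatticeRP.integral_splice_mul_conj_comp_of_shared_nonneg (haarProbability G)
    (IsTiltedFrame.mirrorBlock k k h) (IsTiltedFrame.posBlock e k k h) ∅ (configReflect e k θ)
    hF.measurePreserving_configReflect
    (fun U l hl => hF.configReflect_apply_of_mem_mirrorBlock U l hl)
    (fun l hl => hF.dependsOn_configReflect_apply l hl) IsTiltedFrame.disjoint_mirrorBlock_posBlock
    (Finset.disjoint_empty_right _) (Φ := gObs ρ e k h β F) (measurable_gObs ρ hρ β hFm)
    (norm_gObs_le_abs ρ hρ β hFb) (hF.dependsOn_gObs ρ β hFo)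
  simp only [LatticeRP.splice_eq_piecewise, Finset.piecewise_empty] at key
  unfold productHaar
  rwa [integral_fun_fst (fun U : Config A d G => gObs ρ e k h β F U *
      conj (gObs ρ e k h β F (configReflect e k θ U))), probReal_univ, one_smul] at key

/-- Reflection positivity of the Boltzmann weight `e^{-β S}` at every real `β`. -/
theorem integral_boltzmann_mul_nonneg_anyBeta (hρ : Continuous ρ) (β : ℝ)
    {F : Config A d G → ℂ} (hFm : Measurable F) {CF : ℝ} (hFb : ∀ U, ‖F U‖ ≤ CF)
    (hFo : IsHalfObservable e P h F) :
    0 ≤ ∫ U, (Real.exp (-β * wilsonAction ρ e U) : ℂ) * (conj (F (configReflect e k θ U)) * F U)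
      ∂(productHaar A d G) := by
  have hsplit : ∀ U : Config A d G, (Real.exp (-β * wilsonAction ρ e U) : ℂ) =
      (Real.exp (-β * (N * Fintype.card (Plaq A d))) : ℂ) *
        (Real.exp (β * ∑ p, plaqObs ρ e p U) : ℂ) := fun U => by
    rw [← Complex.ofReal_mul, ← Real.exp_add, wilsonAction_eq]
    congr 2
    ring
  simp_rw [hsplit, mul_assoc]
  rw [integral_const_mul]
  exact mul_nonneg (Complex.zero_le_real.2 (Real.exp_pos _).le)
    (hF.integral_exp_sum_mul_nonneg_anyBeta ρ hρ β hFm hFb hFo)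

/-- **Site-hyperplane reflection positivity of the Wilson measure of a periodic lattice with a site
frame, at EVERY real coupling** (Fröhlich–Israel–Lieb–Simon 1978 Thm. 2.1): for a compact second
countable `G`, continuous `ρ`, `β ∈ ℝ` and every bounded measurable observable `F` of the closed half
`{0 ≤ h ≤ P}`, `0 ≤ ∫ conj F(ΘU) F(U) dμ_β(U)`. Supersedes `integral_conj_mul_nonneg` (`0 ≤ β`). -/
theorem integral_conj_mul_nonneg_anyBeta (hρ : Continuous ρ) (β : ℝ)
    (F : Config A d G → ℂ) (hFm : Measurable F) (hFb : ∃ C : ℝ, ∀ U, ‖F U‖ ≤ C)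
    (hFo : IsHalfObservable e P h F) :
    0 ≤ ∫ U, conj (F (configReflect e k θ U)) * F U ∂(gibbs ρ e β) := by
  obtain ⟨CF, hFb⟩ := hFb
  have hZ := normaliser_pos (A := A) (G := G) ρ hρ e β
  rw [integral_gibbs]
  simp_rw [Complex.real_smul, Complex.ofReal_div, div_eq_mul_inv, mul_comm (Complex.ofReal _)
    ((_ : ℂ)⁻¹), mul_assoc]
  rw [integral_const_mul]
  refine mul_nonneg ?_ (hF.integral_boltzmann_mul_nonneg_anyBeta ρ hρ β hFm hFb hFo)
  rw [← Complex.ofReal_inv]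
  exact Complex.zero_le_real.2 (inv_nonneg.2 hZ.le)

/-- **The site RP blocks are positive semidefinite at every real coupling**: for bounded measurable
half-space observables `F_1, …, F_n`, `c ∈ ℂ^n` and `β ∈ ℝ`,
`0 ≤ ∑_{a,b} conj c_a · c_b · ∫ conj(F_a(ΘU)) F_b(U) dμ_β`. -/
theorem sum_mul_conj_integral_nonneg_anyBeta (hρ : Continuous ρ) (β : ℝ) {n : ℕ}
    (F : Fin n → Config A d G → ℂ) (hFm : ∀ a, Measurable (F a))
    (hFb : ∀ a, ∃ C : ℝ, ∀ U, ‖F a U‖ ≤ C) (hFo : ∀ a, IsHalfObservable e P h (F a)) (c : Fin n → ℂ) :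
    0 ≤ ∑ a, ∑ b, conj (c a) * c b *
      ∫ U, conj (F a (configReflect e k θ U)) * F b U ∂(gibbs ρ e β) := by
  haveI := isProbabilityMeasure_gibbs (A := A) (G := G) ρ hρ e β
  set H : Config A d G → ℂ := fun U => ∑ b, c b * F b U with hH
  have hHm : Measurable H := Finset.measurable_sum _ fun b _ => (hFm b).const_mul _
  choose C hC using hFb
  have hHb : ∃ K : ℝ, ∀ U, ‖H U‖ ≤ K := ⟨∑ b, ‖c b‖ * C b, fun U =>
    (norm_sum_le _ _).trans (Finset.sum_le_sum fun b _ => by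
      rw [norm_mul]; exact mul_le_mul_of_nonneg_left (hC b U) (norm_nonneg _))⟩
  have hHo : IsHalfObservable e P h H := fun U V hUV => by
    simp only [hH]
    exact Finset.sum_congr rfl fun b _ => by rw [hFo b U V hUV]
  have key := hF.integral_conj_mul_nonneg_anyBeta ρ hρ β H hHm hHb hHo
  have hint : ∀ a b, Integrable (fun U => conj (F a (configReflect e k θ U)) * F b U) (gibbs ρ e β) :=
    fun a b => Integrable.of_bound
      (((Complex.continuous_conj.measurable.comp ((hFm a).comp measurable_configReflect)).mul
        (hFm b)).aestronglyMeasurable) (C a * C b) (ae_of_all _ fun U => by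
        rw [norm_mul, Complex.norm_conj]
        exact mul_le_mul (hC a _) (hC b U) (norm_nonneg _) ((norm_nonneg (F a U)).trans (hC a U)))
  have hexp : ∫ U, conj (H (configReflect e k θ U)) * H U ∂(gibbs ρ e β) =
      ∑ a, ∑ b, conj (c a) * c b *
        ∫ U, conj (F a (configReflect e k θ U)) * F b U ∂(gibbs ρ e β) := by
    have h1 : ∀ U, conj (H (configReflect e k θ U)) * H U =
        ∑ a, ∑ b, conj (c a) * c b * (conj (F a (configReflect e k θ U)) * F b U) := fun U => by
      simp only [hH, map_sum, map_mul]
      rw [Finset.sum_mul_sum]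
      exact Finset.sum_congr rfl fun a _ => Finset.sum_congr rfl fun b _ => by ring
    simp_rw [h1]
    rw [integral_finsetSum _ fun a _ => integrable_finsetSum _ fun b _ => (hint a b).const_mul _]
    refine Finset.sum_congr rfl fun a _ => ?_
    rw [integral_finsetSum _ fun b _ => (hint a b).const_mul _]
    exact Finset.sum_congr rfl fun b _ => integral_const_mul _ _
  rwa [hexp] at key

end IsSiteFrame

/-! ## The tilted box along an axis `k ∉ {i, j}`, every real coupling -/

section TiltedBox

variable {d : ℕ} {i j k : Fin d} {Mu Mv Q N : ℕ} [NeZero Mu] [NeZero Mv] [NeZero Q]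
variable {G : Type*} [Group G] [TopologicalSpace G] [IsTopologicalGroup G] [CompactSpace G]
  [MeasurableSpace G] [BorelSpace G] [SecondCountableTopology G]
variable (ρ : G →* Matrix (Fin N) (Fin N) ℂ)

/-- **Site-hyperplane RP of the 45°-tilted periodic box along `k ∉ {i, j}` (period `2Q`, `Q ≥ 2`)
at EVERY real coupling**: `0 ≤ ∫ conj F(ΘU) · F(U) dμ_β(U)` for every bounded measurable `F` of the
closed half `{0 ≤ x_k ≤ Q}`. Supersedes `tiltedBox_siteRP` (`0 ≤ β`). -/
theorem tiltedBox_siteRP_anyBeta (hki : k ≠ i) (hkj : k ≠ j) (hQ : 2 ≤ Q) (hρ : Continuous ρ)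
    (β : ℝ) (F : Config (TiltedSite d i j Mu Mv (2 * Q)) d G → ℂ) (hFm : Measurable F)
    (hFb : ∃ C : ℝ, ∀ U, ‖F U‖ ≤ C)
    (hFo : IsHalfObservable (tiltedUnit d i j Mu Mv (2 * Q)) Q (tiltedCoord d Mu Mv (2 * Q) hki hkj) F) :
    0 ≤ ∫ U, conj (F (configReflect (tiltedUnit d i j Mu Mv (2 * Q)) k
        (tiltedReflect d Mu Mv (2 * Q) hki hkj) U)) * F U ∂(gibbs ρ (tiltedUnit d i j Mu Mv (2 * Q)) β) :=
  (isSiteFrame_tiltedBox d Mu Mv hki hkj hQ).integral_conj_mul_nonneg_anyBeta ρ hρ β F hFm hFb hFo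

/-- **The site RP blocks of the tilted box are positive semidefinite at every real coupling**
(`k ∉ {i, j}`, `L = 2Q`, `Q ≥ 2`). Supersedes `tiltedBox_rSiteBlock_nonneg` (`0 ≤ β`). -/
theorem tiltedBox_rSiteBlock_nonneg_anyBeta (hki : k ≠ i) (hkj : k ≠ j) (hQ : 2 ≤ Q)
    (hρ : Continuous ρ) (β : ℝ) {n : ℕ} (F : Fin n → Config (TiltedSite d i j Mu Mv (2 * Q)) d G → ℂ)
    (hFm : ∀ a, Measurable (F a)) (hFb : ∀ a, ∃ C : ℝ, ∀ U, ‖F a U‖ ≤ C)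
    (hFo : ∀ a, IsHalfObservable (tiltedUnit d i j Mu Mv (2 * Q)) Q
      (tiltedCoord d Mu Mv (2 * Q) hki hkj) (F a)) (c : Fin n → ℂ) :
    0 ≤ ∑ a, ∑ b, conj (c a) * c b *
      ∫ U, conj (F a (configReflect (tiltedUnit d i j Mu Mv (2 * Q)) k
        (tiltedReflect d Mu Mv (2 * Q) hki hkj) U)) * F b U ∂(gibbs ρ (tiltedUnit d i j Mu Mv (2 * Q)) β) :=
  (isSiteFrame_tiltedBox d Mu Mv hki hkj hQ).sum_mul_conj_integral_nonneg_anyBeta ρ hρ β F hFm hFb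
    hFo c

end TiltedBox

/-! ## The cubic torus `(ℤ/2Q)^d`, every axis, every real coupling -/

section CubicTorus

variable {d Q N : ℕ} [NeZero Q]
variable {G : Type} [Group G] [TopologicalSpace G] [IsTopologicalGroup G] [CompactSpace G]
  [MeasurableSpace G] [BorelSpace G] [SecondCountableTopology G]
variable (ρ : G →* Matrix (Fin N) (Fin N) ℂ)

/-- **Site-hyperplane reflection positivity of the torus Wilson measure along every axis, at EVERY
real coupling** (Fröhlich–Israel–Lieb–Simon 1978 Thm. 2.1). On the even torus `(ℤ/2Q)^d`, `Q ≥ 2`,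
for a compact second countable `G`, continuous `ρ`, `β ∈ ℝ`, every axis `k` and every bounded
measurable `F` of the closed half `{0 ≤ x_k ≤ Q}`: `0 ≤ ∫ conj F(Θ'U) · F(U) dμ_β(U)`,
`μ_β = wilsonMeasure ρ β`. Supersedes `cubicTorus_siteRP` (`0 ≤ β`). -/
theorem cubicTorus_siteRP_anyBeta (hQ : 2 ≤ Q) (k : Fin d) (hρ : Continuous ρ) (β : ℝ)
    (F : GaugeConfig d (2 * Q) G → ℂ) (hFm : Measurable F) (hFb : ∃ C : ℝ, ∀ U, ‖F U‖ ≤ C)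
    (hFo : IsHalfObservable (cubicUnit d (2 * Q)) Q (cubicAxisCoord d (2 * Q) k) F) :
    0 ≤ ∫ U, conj (F (configReflect (cubicUnit d (2 * Q)) k (cubicAxisReflect d (2 * Q) k) U)) * F U
      ∂(wilsonMeasure (d := d) (L := 2 * Q) ρ β) := by
  rw [← gibbs_cubicUnit_eq_wilsonMeasure ρ hρ β]
  exact (isSiteFrame_cubicTorus d hQ k).integral_conj_mul_nonneg_anyBeta ρ hρ β F hFm hFb hFo

/-- **The site RP blocks of the torus are positive semidefinite at every real coupling** (every axis
`k`, `L = 2Q ≥ 4`, `β ∈ ℝ`): the site reflection-positivity blocks of a torus bootstrap are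
SIGN-FREE constraints. Supersedes `cubicTorus_siteRP_blocks_nonneg` (`0 ≤ β`). -/
theorem cubicTorus_siteRP_blocks_nonneg_anyBeta (hQ : 2 ≤ Q) (k : Fin d) (hρ : Continuous ρ)
    (β : ℝ) {n : ℕ} (F : Fin n → GaugeConfig d (2 * Q) G → ℂ) (hFm : ∀ a, Measurable (F a))
    (hFb : ∀ a, ∃ C : ℝ, ∀ U, ‖F a U‖ ≤ C)
    (hFo : ∀ a, IsHalfObservable (cubicUnit d (2 * Q)) Q (cubicAxisCoord d (2 * Q) k) (F a))
    (c : Fin n → ℂ) :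
    0 ≤ ∑ a, ∑ b, conj (c a) * c b *
      ∫ U, conj (F a (configReflect (cubicUnit d (2 * Q)) k (cubicAxisReflect d (2 * Q) k) U)) * F b U
        ∂(wilsonMeasure (d := d) (L := 2 * Q) ρ β) := by
  rw [← gibbs_cubicUnit_eq_wilsonMeasure ρ hρ β]
  exact (isSiteFrame_cubicTorus d hQ k).sum_mul_conj_integral_nonneg_anyBeta ρ hρ β F hFm hFb hFo c

/-- **Along the time axis, in Wave 0's notation, at every real coupling**: site RP of
`wilsonMeasure` for Wave 0's `Θ' = GaugeConfig.negReflect` and the frame's half-space observables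
(`d ≥ 1`, `L = 2Q ≥ 4`, `β ∈ ℝ`) — the hypotheses of Wave 0's `wilsonExpectation_siteReflectionPositive`
up to the observable class (identified in `CubicTorusWave0Classes.lean`). -/
theorem cubicTorus_siteRP_negReflect_anyBeta [NeZero d] (hQ : 2 ≤ Q) (hρ : Continuous ρ) (β : ℝ)
    (F : GaugeConfig d (2 * Q) G → ℂ) (hFm : Measurable F) (hFb : ∃ C : ℝ, ∀ U, ‖F U‖ ≤ C)
    (hFo : IsHalfObservable (cubicUnit d (2 * Q)) Q (cubicAxisCoord d (2 * Q) 0) F) :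
    0 ≤ ∫ U, conj (F U.negReflect) * F U ∂(wilsonMeasure (d := d) (L := 2 * Q) ρ β) := by
  have h := cubicTorus_siteRP_anyBeta ρ hQ 0 hρ β F hFm hFb hFo
  simp_rw [configReflect_cubicUnit_zero] at h
  exact h

end CubicTorus

/-! ## The venture's gauge groups at every real coupling -/

section GaugeGroups

variable {d Q N : ℕ} [NeZero Q]

/-- **Site-hyperplane RP of `SU(N)` lattice Yang–Mills on the even torus `(ℤ/2Q)^d` along every
axis `k`, at EVERY real coupling** (fundamental representation; `Q ≥ 2`; every `N`, every `d`). -/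
theorem cubicTorus_siteRP_suN_anyBeta (hQ : 2 ≤ Q) (k : Fin d) (β : ℝ)
    (F : GaugeConfig d (2 * Q) (Matrix.specialUnitaryGroup (Fin N) ℂ) → ℂ) (hFm : Measurable F)
    (hFb : ∃ C : ℝ, ∀ U, ‖F U‖ ≤ C)
    (hFo : IsHalfObservable (cubicUnit d (2 * Q)) Q (cubicAxisCoord d (2 * Q) k) F) :
    0 ≤ ∫ U, conj (F (configReflect (cubicUnit d (2 * Q)) k (cubicAxisReflect d (2 * Q) k) U)) * F U
      ∂(wilsonMeasure (d := d) (L := 2 * Q) (fundamentalRep (Fin N)) β) := by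
  haveI : SecondCountableTopology (Matrix (Fin N) (Fin N) ℂ) :=
    inferInstanceAs (SecondCountableTopology (Fin N → Fin N → ℂ))
  haveI : SecondCountableTopology (Matrix.specialUnitaryGroup (Fin N) ℂ) :=
    Topology.IsEmbedding.subtypeVal.secondCountableTopology
  exact cubicTorus_siteRP_anyBeta (fundamentalRep (Fin N)) hQ k (continuous_fundamentalRep (Fin N)) β
    F hFm hFb hFo

/-- **Site-hyperplane RP of `U(N)` lattice gauge theory on the even torus along every axis `k`, at
EVERY real coupling** (fundamental representation; `Q ≥ 2`; every `N`, `U(1)` included). -/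
theorem cubicTorus_siteRP_uN_anyBeta (hQ : 2 ≤ Q) (k : Fin d) (β : ℝ)
    (F : GaugeConfig d (2 * Q) (Matrix.unitaryGroup (Fin N) ℂ) → ℂ) (hFm : Measurable F)
    (hFb : ∃ C : ℝ, ∀ U, ‖F U‖ ≤ C)
    (hFo : IsHalfObservable (cubicUnit d (2 * Q)) Q (cubicAxisCoord d (2 * Q) k) F) :
    0 ≤ ∫ U, conj (F (configReflect (cubicUnit d (2 * Q)) k (cubicAxisReflect d (2 * Q) k) U)) * F U
      ∂(wilsonMeasure (d := d) (L := 2 * Q) (unitaryFundamentalRep (Fin N) ℂ) β) := by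
  haveI : SecondCountableTopology (Matrix (Fin N) (Fin N) ℂ) :=
    inferInstanceAs (SecondCountableTopology (Fin N → Fin N → ℂ))
  haveI : SecondCountableTopology (Matrix.unitaryGroup (Fin N) ℂ) :=
    Topology.IsEmbedding.subtypeVal.secondCountableTopology
  exact cubicTorus_siteRP_anyBeta (unitaryFundamentalRep (Fin N) ℂ) hQ k
    (continuous_unitaryFundamentalRep (n := Fin N) (𝕜 := ℂ)) β F hFm hFb hFo

end GaugeGroups

end TiltedRP

end Summit.QuantumFields.GaugeBoot
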